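import Literature.AlgebraicGeometry.Resolution.KnafKuhlmann2009Lemma216
import Literature.AlgebraicGeometry.Resolution.Kuhlmann2019HenselianRationalityLemmas
import Literature.AlgebraicGeometry.Resolution.HenselizationDefectless
import Literature.AlgebraicGeometry.Resolution.HenselizationHenselian
import Literature.AlgebraicGeometry.Resolution.HenselizationDensity
import Literature.AlgebraicGeometry.Resolution.HenselizedRationalDensity
import Literature.AlgebraicGeometry.Resolution.SubfieldTransport
import Literature.AlgebraicGeometry.Resolution.SmoothUniformization
import Literature.AlgebraicGeometry.Resolution.DefectTransport
import Literature.AlgebraicGeometry.Resolution.AbhyankarEtaleAscent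
import HarnessLib

/-!
# KaplanskyDefectlessType — Kaplansky's theorem over a rank-one defectless base, without pseudo-convergent
sequences (PROVED), file 1/2

PROVED valuation theory (no ports, no named facts; summit-free mathematics, homed under `Summits/…/Theorems`
because the gate's Literature lint admits only
PUBLISHED statements with per-declaration cite tags and this ARGUMENT is new — dry-run 2026-08-30T22:5xZ; the
critic's plan item (K) named Literature/): Kaplansky's
/-- `«no`: Auxiliary step of this node's calculus, VERBATIM from the lens file (see the module docstring); the
statement is its type. [folklore] -/
theorem «no algebraic pseudo-limits over a rank-one DEFECTLESS base» WITHOUT pseudo-convergent sequences —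
root-wise eventual constancy of values
+ a Hasse–Taylor good-radius estimate show that an algebraic pseudo-limit of degree `d ≥ 2` over the
henselization `F^h` would generate a proper
IMMEDIATE finite extension of `F^h`, killed by henselian + defectless (Kuhlmann 2010 Thm 2.14, tree
`HenselizationDefectless`) with NO separability
hypothesis; degree 1 by rank-one density (Kuhlmann 2010 Lemma 2.4, tree `HenselizationDensity`).  It is the
INSEPARABLE-capable companion of the
tree's `KnafKuhlmann2009Lemma216` (`kaplansky_condition_of_isSepClosed`, whose helpers `exists_valuation_sub_lt`,
`coeff_hasseDeriv_mem` are reused)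
and of `Kuhlmann2019HenselianRationalityLemmas` (twins `relfinrank_eq_relIndex_mul_relfinrank_of_isDefectlessField`,
`eq_of_isDefectlessField_of_immediate`).
Content VERBATIM from the decomp-res lens-1 g19 rev 1 TREE-FACING COMPANION
`HOME/decomp-res-lens-1/g19/tree/DefectlessLadderTree.lean` (sha256
45a9879c65cfd008…, §25 A–C = l. 946–1566; node `g19/DefectlessLadder.lean` bf11eb22…, CRITIC-LEDGER row
145; landing plan item (K) of the lens's
WRITER.md, endorsed by decomp-res-crit-1 g5 2026-08-30T21:39:44Z), namespace `…Theorems.DefectlessLadder` as in the companion;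
the near-duplicate `eval_mem_subfield_of_coeff_mem` is NOT re-landed — its two uses
cite the tree's `AbhyankarEtaleAscent.eval_mem_of_coeff_mem` (critic).  HOME = run/shared/lean/pub/decomp-res.  Used by
`Theorems/DefectlessLadder` to PROVE the decomp-res bridge `KaplanskyLadder.TratOfDefectlessBase`; landed as SUPPORT
(helper) of Valuative 0641.

§25-A ambient lemmas (`EvConst`, `IsPseudoLimit` helper defs; root-wise eventual constancy `evConst_*`, `exists_ball_avoid`,
`exists_one_lt_valuation_of_immediate`, Hasse–Taylor `eval_eq_sum_hasseDeriv` / `eval_sub_eval_eq_sum`,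
`isIntegral_of_mem_roots_of_coeff_mem`,
`valuation_radius_unique`); §25-B the kill: henselian defectless fields have no proper immediate finite extensions
(`relfinrank_eq_relIndex_mul_relfinrank_of_isDefectlessField`, `eq_of_isDefectlessField_of_immediate`).  §25-C (the
theorem) is file 2/2
`KaplanskyDefectless`.

(Sources: Kaplansky1942 (Duke Math. J. 9) Lemma 5, Thm 3; Kuhlmann2010 arXiv:1003.5678 Lemma 2.4, Thm 2.14; Kuhlmann
arXiv:1004.2135 Thm 3; KnafKuhlmann2009 arXiv:math/0702856 Lemma 2.16.)
-/

noncomputable section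

open IsLocalRing Literature.AlgebraicGeometry.Resolution
open Polynomial

universe u

namespace Summit.ResolutionOfSingularities.ResolutionOfSingularities.Theorems.DefectlessLadder

/-! ## 25. Kaplansky's theorem over a rank-one defectless base, without pseudo-convergent sequences (KERNEL)

Sources of the ARGUMENT (not ports — everything below is proved): Kaplansky 1942 (Duke Math. J. 9) Lemma 5 and
Thm. 3 [the statements bypassed]; Kuhlmann 2010 (arXiv:1003.5678) Lemma 2.4 (density, tree
`HenselizationDensity`), Thm. 2.14 (defectless ⇔ henselization defectless, tree `HenselizationDefectless`);
Kuhlmann, *The defect* (arXiv:1004.2135) Thm. 3 p. 3; Knaf–Kuhlmann 2009 Lemma 2.16 (tree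
`KnafKuhlmann2009Lemma216`: the separably-closed special case `kaplansky_condition_of_isSepClosed`, whose
helper lemmas `exists_valuation_sub_lt`, `coeff_hasseDeriv_mem` are reused). -/

section Ambient

variable {Ω : Type u} [Field Ω] (V : ValuationSubring Ω) (F : Subfield Ω)

/-- HELPER DEFINITION (not a piece; §25-A): eventually constant NON-ZERO value of `q(a)` for `a ∈ F` close
to `z` (on an `F`-ball `{a ∈ F : v(z - a) ≤ v(z - a₀)}` around `z`). -/
def EvConst (z : Ω) (q : Polynomial Ω) : Prop :=
  ∃ a₀ ∈ F, ∃ α : V.ValueGroup, α ≠ 0 ∧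
    ∀ a ∈ F, V.valuation (z - a) ≤ V.valuation (z - a₀) → V.valuation (q.eval a) = α

/-- HELPER DEFINITION (not a piece; §25-A): `θ` is a PSEUDO-LIMIT of `z` over `F` — `θ` is closer to `z`
than every element of `F` (Kaplansky 1942 §2, for the pseudo-convergent sets `{a ∈ F}` filtered by
`v(z - a)`; no sequences are used). -/
def IsPseudoLimit (z θ : Ω) : Prop := ∀ a ∈ F, V.valuation (z - θ) < V.valuation (z - a)

variable {V F}

/-- `evConst_mul`: Auxiliary step of this node's calculus, VERBATIM from the lens file (see the module docstring);
the statement is its type. [folklore] -/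
theorem evConst_mul {z : Ω} {f g : Polynomial Ω} (hf : EvConst V F z f) (hg : EvConst V F z g) :
    EvConst V F z (f * g) := by
  obtain ⟨a₁, ha₁, α₁, hα₁, h₁⟩ := hf
  obtain ⟨a₂, ha₂, α₂, hα₂, h₂⟩ := hg
  rcases le_total (V.valuation (z - a₁)) (V.valuation (z - a₂)) with h | h
  · refine ⟨a₁, ha₁, α₁ * α₂, mul_ne_zero hα₁ hα₂, fun a ha hle => ?_⟩
    rw [eval_mul, map_mul, h₁ a ha hle, h₂ a ha (hle.trans h)]
  · refine ⟨a₂, ha₂, α₁ * α₂, mul_ne_zero hα₁ hα₂, fun a ha hle => ?_⟩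
    rw [eval_mul, map_mul, h₁ a ha (hle.trans h), h₂ a ha hle]

variable (V F) in

/-- `evConst_C`: Auxiliary step of this node's calculus, VERBATIM from the lens file (see the module docstring); the
statement is its type. [folklore] -/
theorem evConst_C (z : Ω) {c : Ω} (hc : c ≠ 0) : EvConst V F z (C c) :=
  ⟨0, F.zero_mem, V.valuation c, (_root_.map_ne_zero _).mpr hc, fun a _ _ => by rw [eval_C]⟩

/-- `not_isPseudoLimit_iff`: Auxiliary step of this node's calculus, VERBATIM from the lens file (see the module
docstring); the statement is its type. [folklore] -/
theorem not_isPseudoLimit_iff {z θ : Ω} :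
    ¬ IsPseudoLimit V F z θ ↔ ∃ a ∈ F, V.valuation (z - a) ≤ V.valuation (z - θ) := by
  simp only [IsPseudoLimit, not_forall, not_lt, exists_prop]

/-- A pseudo-limit is as far from each `a ∈ F` as `z` is. [folklore] -/
theorem IsPseudoLimit.valuation_sub {z θ : Ω} (h : IsPseudoLimit V F z θ) {a : Ω} (ha : a ∈ F) :
    V.valuation (θ - a) = V.valuation (z - a) := by
  have : θ - a = (z - a) - (z - θ) := by ring
  rw [this]
  exact Valuation.map_sub_eq_of_lt_left _ (h a ha)

/-- `evConst_X_sub_C`: Auxiliary step of this node's calculus, VERBATIM from the lens file (see the module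
docstring); the statement is its type. [folklore] -/
theorem evConst_X_sub_C {z : Ω} (hzF : z ∉ F)
    (hval : ∀ w ∈ Subfield.closure ((F : Set Ω) ∪ {z}), w ≠ 0 → ∃ b ∈ F,
      V.valuation w = V.valuation b)
    (hres : ∀ w ∈ Subfield.closure ((F : Set Ω) ∪ {z}), w ∈ V → ∃ c ∈ F,
      V.valuation (w - c) < 1)
    {θ : Ω} (hθ : ¬ IsPseudoLimit V F z θ) : EvConst V F z (X - C θ) := by
  obtain ⟨a₁, ha₁, h₁⟩ := not_isPseudoLimit_iff.mp hθ
  obtain ⟨a₀, ha₀, hlt⟩ := exists_valuation_sub_lt V F hzF hval hres ha₁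
  have hlt' : V.valuation (z - a₀) < V.valuation (z - θ) := lt_of_lt_of_le hlt h₁
  refine ⟨a₀, ha₀, V.valuation (z - θ), (lt_of_le_of_lt zero_le hlt').ne', fun a ha hle => ?_⟩
  rw [eval_sub, eval_X, eval_C]
  have : a - θ = (z - θ) - (z - a) := by ring
  rw [this]
  exact Valuation.map_sub_eq_of_lt_left _ (lt_of_le_of_lt hle hlt')

/-- `evConst_prod_X_sub_C`: Auxiliary step of this node's calculus, VERBATIM from the lens file (see the module
docstring); the statement is its type. [folklore] -/
theorem evConst_prod_X_sub_C {z : Ω} (hzF : z ∉ F)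
    (hval : ∀ w ∈ Subfield.closure ((F : Set Ω) ∪ {z}), w ≠ 0 → ∃ b ∈ F,
      V.valuation w = V.valuation b)
    (hres : ∀ w ∈ Subfield.closure ((F : Set Ω) ∪ {z}), w ∈ V → ∃ c ∈ F,
      V.valuation (w - c) < 1)
    (s : Multiset Ω) (hs : ∀ θ ∈ s, ¬ IsPseudoLimit V F z θ) :
    EvConst V F z (s.map (X - C ·)).prod := by
  induction s using Multiset.induction_on with
  | empty =>
    rw [Multiset.map_zero, Multiset.prod_zero, ← C_1]
    exact evConst_C V F z one_ne_zero
  | cons θ s ih =>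
    rw [Multiset.map_cons, Multiset.prod_cons]
    exact evConst_mul (evConst_X_sub_C hzF hval hres (hs θ (Multiset.mem_cons_self _ _)))
      (ih fun θ' h' => hs θ' (Multiset.mem_cons_of_mem h'))

/-- **Lemma 1.** A non-zero polynomial none of whose roots (in the algebraically closed `Ω`) is a
pseudo-limit of `z` over `F` has eventually constant non-zero value on `F` near `z`. [folklore] -/
theorem evConst_of_roots [IsAlgClosed Ω] {z : Ω} (hzF : z ∉ F)
    (hval : ∀ w ∈ Subfield.closure ((F : Set Ω) ∪ {z}), w ≠ 0 → ∃ b ∈ F,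
      V.valuation w = V.valuation b)
    (hres : ∀ w ∈ Subfield.closure ((F : Set Ω) ∪ {z}), w ∈ V → ∃ c ∈ F,
      V.valuation (w - c) < 1)
    {q : Polynomial Ω} (hq : q ≠ 0) (hroots : ∀ θ ∈ q.roots, ¬ IsPseudoLimit V F z θ) :
    EvConst V F z q := by
  rw [(IsAlgClosed.splits q).eq_prod_roots]
  exact evConst_mul (evConst_C V F z (leadingCoeff_ne_zero.mpr hq))
    (evConst_prod_X_sub_C hzF hval hres q.roots hroots)

/-- **Avoiding finitely many radii.** Inside any `F`-ball around `z` there is a smaller `F`-ball on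
which the radius `v(z - a)` avoids a given finite set of values. [folklore] -/
theorem exists_ball_avoid {z : Ω} (hzF : z ∉ F)
    (hval : ∀ w ∈ Subfield.closure ((F : Set Ω) ∪ {z}), w ≠ 0 → ∃ b ∈ F,
      V.valuation w = V.valuation b)
    (hres : ∀ w ∈ Subfield.closure ((F : Set Ω) ∪ {z}), w ∈ V → ∃ c ∈ F,
      V.valuation (w - c) < 1)
    (S : Finset V.ValueGroup) {a₁ : Ω} (ha₁ : a₁ ∈ F) :
    ∃ a₂ ∈ F, V.valuation (z - a₂) ≤ V.valuation (z - a₁) ∧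
      ∀ a ∈ F, V.valuation (z - a) ≤ V.valuation (z - a₂) → V.valuation (z - a) ∉ S := by
  classical
  induction S using Finset.induction_on generalizing a₁ with
  | empty => exact ⟨a₁, ha₁, le_rfl, fun a _ _ => by simp⟩
  | insert r S hr ih =>
    obtain ⟨a₂, ha₂, h₂₁, h₂r⟩ : ∃ a₂ ∈ F, V.valuation (z - a₂) ≤ V.valuation (z - a₁) ∧
        ∀ a ∈ F, V.valuation (z - a) ≤ V.valuation (z - a₂) → V.valuation (z - a) ≠ r := by
      by_cases hex : ∃ c ∈ F, V.valuation (z - c) ≤ r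
      · obtain ⟨c, hc, hcr⟩ := hex
        obtain ⟨c', hc', hlt⟩ := exists_valuation_sub_lt V F hzF hval hres hc
        rcases le_total (V.valuation (z - c')) (V.valuation (z - a₁)) with h | h
        · exact ⟨c', hc', h, fun a ha hle => ne_of_lt (lt_of_le_of_lt hle (lt_of_lt_of_le hlt hcr))⟩
        · exact ⟨a₁, ha₁, le_rfl, fun a ha hle =>
            ne_of_lt (lt_of_le_of_lt (hle.trans h) (lt_of_lt_of_le hlt hcr))⟩
      · push Not at hex
        exact ⟨a₁, ha₁, le_rfl, fun a ha _ => ne_of_gt (hex a ha)⟩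
    obtain ⟨a₃, ha₃, h₃₂, h₃S⟩ := ih ha₂
    refine ⟨a₃, ha₃, h₃₂.trans h₂₁, fun a ha hle => ?_⟩
    rw [Finset.mem_insert, not_or]
    exact ⟨h₂r a ha (hle.trans h₃₂), h₃S a ha hle⟩

/-- The valuation is non-trivial on `F` as soon as `F(z)|F` is immediate with `z ∉ F`. [folklore] -/
theorem exists_one_lt_valuation_of_immediate {z : Ω} (hzF : z ∉ F)
    (hval : ∀ w ∈ Subfield.closure ((F : Set Ω) ∪ {z}), w ≠ 0 → ∃ b ∈ F,
      V.valuation w = V.valuation b)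
    (hres : ∀ w ∈ Subfield.closure ((F : Set Ω) ∪ {z}), w ∈ V → ∃ c ∈ F,
      V.valuation (w - c) < 1) :
    ∃ a ∈ F, 1 < V.valuation a := by
  by_contra hno
  push Not at hno
  -- every non-zero element of `F` has value `1`
  have hone : ∀ a ∈ F, a ≠ 0 → V.valuation a = 1 := by
    intro a ha ha0
    refine le_antisymm (hno a ha) ?_
    by_contra hlt
    push Not at hlt
    have h1 : 1 < V.valuation a⁻¹ := by
      rw [map_inv₀]
      exact one_lt_inv_iff₀.mpr ⟨(Valuation.pos_iff _).mpr ha0, hlt⟩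
    exact absurd (hno a⁻¹ (F.inv_mem ha)) (not_le.mpr h1)
  set E := Subfield.closure ((F : Set Ω) ∪ {z}) with hE
  have hFE : ∀ x ∈ F, x ∈ E := fun x hx => Subfield.subset_closure (Or.inl hx)
  have hzE : z ∈ E := Subfield.subset_closure (Or.inr rfl)
  have hEone : ∀ w ∈ E, w ≠ 0 → V.valuation w = 1 := by
    intro w hw hw0
    obtain ⟨b, hb, hwb⟩ := hval w hw hw0
    have hb0 : b ≠ 0 := by
      rintro rfl
      rw [map_zero, map_eq_zero] at hwb
      exact hw0 hwb
    rw [hwb, hone b hb hb0]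
  have hz0 : z ≠ 0 := fun h => hzF (h ▸ F.zero_mem)
  have hzV : z ∈ V := (V.valuation_le_one_iff z).mp (hEone z hzE hz0).le
  obtain ⟨c, hc, hlt⟩ := hres z hzE hzV
  have hzc : z - c ≠ 0 := fun h => hzF (by rw [sub_eq_zero.mp h]; exact hc)
  have := hEone (z - c) (sub_mem hzE (hFE c hc)) hzc
  rw [this] at hlt
  exact lt_irrefl _ hlt

/-- Hasse–Taylor expansion: `h(x) = Σᵢ h^{[i]}(a) (x - a)^i`. [folklore] -/
theorem eval_eq_sum_hasseDeriv (h : Polynomial Ω) (x a : Ω) :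
    h.eval x = ∑ i ∈ Finset.range (h.natDegree + 1), (hasseDeriv i h).eval a * (x - a) ^ i := by
  have h1 : h.eval x = (taylor a h).eval (x - a) := by rw [taylor_eval, sub_add_cancel]
  rw [h1, eval_eq_sum_range, natDegree_taylor]
  exact Finset.sum_congr rfl fun i _ => by rw [taylor_coeff]

/-- `h(x) - h(a) = Σ_{i ≥ 1} h^{[i]}(a) (x - a)^i`. [folklore] -/
theorem eval_sub_eval_eq_sum (h : Polynomial Ω) (x a : Ω) :
    h.eval x - h.eval a =
      ∑ i ∈ Finset.range h.natDegree, (hasseDeriv (i + 1) h).eval a * (x - a) ^ (i + 1) := by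
  rw [eval_eq_sum_hasseDeriv h x a, Finset.sum_range_succ', hasseDeriv_zero', pow_zero, mul_one,
    add_sub_cancel_right]

/-- A root of a non-zero polynomial with coefficients in `L ≤ Ω` is integral over `L` of degree at
most the degree of the polynomial. [folklore] -/
theorem isIntegral_of_mem_roots_of_coeff_mem {L : Subfield Ω} {h : Polynomial Ω} (hc : ∀ i, h.coeff i ∈ L)
    (h0 : h ≠ 0) {θ : Ω} (hθ : θ ∈ h.roots) :
    IsIntegral L θ ∧ (minpoly L θ).natDegree ≤ h.natDegree := by
  obtain ⟨q, hq⟩ : ∃ q : Polynomial L, q.map (algebraMap L Ω) = h := by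
    rw [← Polynomial.mem_lifts]
    exact (Polynomial.lifts_iff_coeff_lifts h).mpr fun i => ⟨⟨h.coeff i, hc i⟩, rfl⟩
  have hq0 : q ≠ 0 := by
    rintro rfl
    rw [Polynomial.map_zero] at hq
    exact h0 hq.symm
  have hroot : aeval θ q = 0 := by
    rw [aeval_def, ← eval_map, hq]
    exact ((mem_roots h0).mp hθ).eq_zero
  have halg : IsAlgebraic L θ := ⟨q, hq0, hroot⟩
  refine ⟨halg.isIntegral, ?_⟩
  calc (minpoly L θ).natDegree ≤ q.natDegree :=
        natDegree_le_natDegree (minpoly.degree_le_of_ne_zero L θ hq0 hroot)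
    _ = h.natDegree := by rw [← hq, natDegree_map]

/-- In a linearly ordered value group the equation `βᵢ rⁱ = βⱼ rʲ` (`i ≠ j`, `βᵢ, βⱼ ≠ 0`) has at
most one non-zero solution `r`. [folklore] -/
theorem valuation_radius_unique {Γ : Type*} [LinearOrderedCommGroupWithZero Γ] {βi βj r s : Γ}
    (hβi : βi ≠ 0) (hβj : βj ≠ 0) (hr : r ≠ 0) (hs : s ≠ 0) {i j : ℕ} (hij : i ≠ j)
    (h₁ : βi * r ^ i = βj * r ^ j) (h₂ : βi * s ^ i = βj * s ^ j) : r = s := by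
  -- reduce to `r ^ m = s ^ m` with `m ≠ 0`
  have key : ∀ {βi βj : Γ} {i j : ℕ}, βi ≠ 0 → βj ≠ 0 → i < j →
      βi * r ^ i = βj * r ^ j → βi * s ^ i = βj * s ^ j → r = s := by
    intro βi βj i j hβi hβj hij h₁ h₂
    have hm : j - i ≠ 0 := Nat.sub_ne_zero_of_lt hij
    have e₁ : βi = βj * r ^ (j - i) := by
      have : βj * r ^ j = (βj * r ^ (j - i)) * r ^ i := by
        rw [mul_assoc, ← pow_add, Nat.sub_add_cancel hij.le]
      rw [this] at h₁
      exact mul_right_cancel₀ (pow_ne_zero _ hr) h₁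
    have e₂ : βi = βj * s ^ (j - i) := by
      have : βj * s ^ j = (βj * s ^ (j - i)) * s ^ i := by
        rw [mul_assoc, ← pow_add, Nat.sub_add_cancel hij.le]
      rw [this] at h₂
      exact mul_right_cancel₀ (pow_ne_zero _ hs) h₂
    have e : r ^ (j - i) = s ^ (j - i) := mul_left_cancel₀ hβj (e₁.symm.trans e₂)
    rcases lt_trichotomy r s with h | h | h
    · exact absurd e (ne_of_lt (pow_lt_pow_left₀ h zero_le hm))
    · exact h
    · exact absurd e.symm (ne_of_lt (pow_lt_pow_left₀ h zero_le hm))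
  rcases Nat.lt_or_gt_of_ne hij with h | h
  · exact key hβi hβj h h₁ h₂
  · exact key hβj hβi h h₁.symm h₂.symm

end Ambient

/-! ### Henselian defectless fields have no proper immediate finite extensions -/

section Kill

variable {Ω : Type u} [Field Ω] {V : ValuationSubring Ω}

/-- **`[E : L] = (vE : vL)·[Ev : Lv]` over a henselian defectless `(L, V ∩ L)`** for every finite
`E ≥ L` inside `Ω`: the unique valuation ring of `E` over `V ∩ L` is `V ∩ E` (henselian), so
"defectless in `E`" reads `[E : L] = e·f`. (The separable twin is the tree's
`relfinrank_eq_relIndex_mul_relfinrank_of_isSeparablyDefectlessField`.) [folklore] -/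
theorem relfinrank_eq_relIndex_mul_relfinrank_of_isDefectlessField {L E : Subfield Ω}
    (hle : L ≤ E) (hLh : IsHenselianField L (V.comap (algebraMap L Ω)))
    (hd : IsDefectlessField L (V.comap (algebraMap L Ω)))
    (hpos : 0 < Subfield.relfinrank L E) :
    Subfield.relfinrank L E =
      (valueSubgroup L V).relIndex (valueSubgroup E V) *
        (residueSubfield L V).relfinrank (residueSubfield E V) := by
  classical
  set E' : IntermediateField L Ω := Subfield.extendScalars hle with hE'
  have hfr : Subfield.relfinrank L E = Module.finrank L E' :=
    Subfield.relfinrank_eq_finrank_of_le hle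
  haveI : FiniteDimensional L E' := by
    rw [hfr] at hpos
    exact Module.finite_of_finrank_pos hpos
  haveI : Algebra.IsAlgebraic L E' := Algebra.IsAlgebraic.of_finite L E'
  set W : ValuationSubring E' := V.comap (algebraMap E' Ω) with hW
  have hover : W.comap (algebraMap L E') = V.comap (algebraMap L Ω) := by
    rw [hW, ValuationSubring.comap_comap, ← IsScalarTower.algebraMap_eq]
  obtain ⟨s, hs, hsum⟩ := hd E' inferInstance
  have hsW : s = {W} := by
    ext O'
    rw [Finset.mem_singleton, hs O']
    constructor
    · intro hO'
      exact hLh E' inferInstance O' W hO' hover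
    · rintro rfl
      exact hover
  rw [hsW, Finset.sum_singleton] at hsum
  have hrange : Set.range (algebraMap E' Ω) = Set.range (algebraMap E Ω) := by
    rw [range_algebraMap_intermediateField, range_algebraMap_subfield, hE',
      Subfield.coe_extendScalars]
  rw [hfr, ← hsum, hW, ramificationIndex_comap_eq_relIndex, inertiaDegree_comap_eq_relfinrank,
    valueSubgroup_eq_of_range_eq V hrange, residueSubfield_eq_of_range_eq V hrange]

/-- **The kill**: over a henselian defectless `(L, V ∩ L)`, a finite `E ≥ L` with `vE = vL` and
`Ev = Lv` (an immediate finite extension) equals `L`. [folklore] -/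
theorem eq_of_isDefectlessField_of_immediate {L E : Subfield Ω} (hle : L ≤ E)
    (hLh : IsHenselianField L (V.comap (algebraMap L Ω)))
    (hd : IsDefectlessField L (V.comap (algebraMap L Ω)))
    (hpos : 0 < Subfield.relfinrank L E)
    (hv : ∀ a ∈ E, a ≠ 0 → ∃ b ∈ L, V.valuation a = V.valuation b)
    (hr : resField V E ≤ resField V L) : E = L := by
  have h := relfinrank_eq_relIndex_mul_relfinrank_of_isDefectlessField hle hLh hd hpos
  rw [valueSubgroup_eq_of_forall_valuation_eq V hle hv, residueSubfield_eq_of_resField_le V hle hr,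
    Subgroup.relIndex_self, Subfield.relfinrank_self, mul_one] at h
  exact le_antisymm (Subfield.relfinrank_eq_one_iff.mp h) hle

end Kill

end Summit.ResolutionOfSingularities.ResolutionOfSingularities.Theorems.DefectlessLadder
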